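import Summits.QuantumFields.BalabanUV.T4Continuum.Support.NE7HdecompOfDbar
import HarnessLib

/-!
# NE7 (pub-balaban, rung (B)+1, d = 4, SU(2), L = 2): THE S2′ CHAIN WITH THE QUARTIC ℓ¹ MASS LINE — `Σ‖μ‖ ≤ m₁·M⁴·‖X‖_w²` costs nothing and is what k-free `m₁` needs

Cell `pub-balaban`, rung (B)+1 sub-cell t4, lineage `b2b-balaban-t4-ne7-p1` (CRUX PROVER NE7 #1 = OWNER of row NE7), generation 98; memo `t4/b2b-balaban-t4-ne7-p1-g98/ROAD-G98.md` §3.4.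

WHY.  The landed S5∕S5′ decompositions (`NE7DecompOfTopNormalised.decomp_of_topNormalised`, `NE7DecompOfDbar.decomp_of_dbar`) and their binders∕ENDs carry the ℓ¹ mass line of the
slice corrector as `Σ_z‖μ(z)‖ ≤ m₁·M³·‖X‖_w²`.  That exponent came from `curlL1_gaugeDir_le_of_mass`, whose proof bounds `x²·M³ ≤ (M²x)²` — throwing away one power of `M`.
SIZE COUNT (memo §3.4, homogeneity∕scaling audit): for the representative ROAD-Γ′ S1 constructs (`sup‖X‖ = b ≍ ε∕M`, residual `X_res ≍ (Mb)·b` per link, corrector `μ` with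
`‖D μ‖₂ ≤ ‖X_res‖₂` and the corner Poincaré `‖μ‖₂ ≤ 2M‖Dμ‖₂`), `Σ_z‖μ(z)‖ ≍ c·(Mb)·M⁴·‖X‖_w²` — so the CUBIC line needs `m₁ ≍ c·α̂·M` (NOT k-free) while the QUARTIC line
holds with `m₁ ≍ c·α̂`.  And the quartic line costs NOTHING: `x·Σ_p‖curl_W(D_Wμ)(p)‖ ≤ 2·#Plane·x²·Σ‖μ‖ ≤ 2·#Plane·(M²x)²·m₁·‖X‖_w²` EXACTLY (`x²M⁴ = (M²x)²`).  THIS FILE re-issues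
the S2′ chain with exponent 4: `curlL1_gaugeDir_le_of_mass_M4`, `decomp_of_dbar_M4` (S5′), `hdecomp_body_of_dbar_M4` (binder′); the END `NE7HintOfDbarSU2M4.hint_SU2_of_dbar_M4`
follows in its own file.  Conclusions and constants are byte-identical to the cubic versions; only the hypothesis is weaker.

HONEST FRAMING (page 1): composition and real arithmetic over landed kernel theorems; nothing of Bałaban's asserted; the masses remain hypotheses (now correctly scaled); NE7 NOT
PROVED; spine 0∕9; finite T⁴ rung (B)+1 — NOT infinite volume, NOT mass gap, NOT `BetaPertH`, NOT Clay.  Continuum YM on T⁴ ⇐ BetaPertH ∧ nine spine estimates (0/9 proved).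

WHAT ([folklore]; 0 def, 0 sorry).  §1 `curlL1_gaugeDir_le_of_mass_M4` (general `d, L`); §2 `decomp_of_dbar_M4` (general `d, L`); §3 `hdecomp_body_of_dbar_M4` (`d = 4`, `L = 2`).
-/

namespace Summit.QuantumFields.BalabanUV.T4Continuum.NE7DbarChainM4

open scoped BigOperators Matrix Matrix.Norms.L2Operator Topology
open NormedSpace Finset Set Filter

open Literature.MathematicalPhysics.QuantumFieldTheory.Balaban1983to89
open B7Prop1Explicit B7Prop2Explicit B7Prop3Flat MatrixLog
open T4AveragingDeficitWall (Ad IsUnitaryCfg IsSkewDir SmallField vary curl dirL1 dirSq curlSq)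
open T4AveragingDeficitWallBoundary (IsPeriodicCfg periodBox)
open AveragingDeficitPeriodicCounting (IsPeriodicDir)
open AveragingDeficitMultiLevelPrep (cavgIter LevelSmall tower TangentIter)
open B7Eq92Concrete (vcov)
open NE3TangentCovariantTower (dirIter QbarIter framePotW tangentIter_iff_dirIter_eq_zero)
open NE3.PairLandauB8Avg (relPert)
open ReplicationRightInverseBound (radSum)
open BlockAverageVaryHolo (nbRad)
open NE3CovariantLineSumsError (Csup)
open ShellMeasureAverageProp4General (C1cov C1cov_pos)
open BlockAveragePushDirGauge (gaugeDir isPeriodicDir_gaugeDir)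
open NE3CornerSpikes (spikeW)
open NE3QbarIterCovLiftPrep (cruxC)
open NE3SmoothRightInverseW (rightInvW)
open NE3RightInverseSolveLetters (thetaLoc)
open NE3RightInverseL2Letter (l2C l2C_nonneg)
open NE3HatInvCurlLetters (curl2C curl1C curl2C_nonneg curl1C_nonneg)
open NE3EnergyWeightedShapes (energyNormW energyNormW_nonneg)
open NE3ProductPathBounds (energyNormW_sub_le curl_sub_dir)
open NE3EnergyHessContTwoTerm (curlSq_nonneg dirSq_nonneg)
open NE3SmoothLiftW (tower_eq_pow_mul)
open NE3LandauOrbit (gaugeDir_skew)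
open NE3FrameFreeSliceW (frameFreeBlockLandauW)
open NE3FrameFreeDecompositionW (exists_cornerGauge_mem_frameFreeBlockLandauW)
open NE3CurlOfGaugeDir (curlSq_gaugeDir_le)
open MinimalActionLevels (perWin)
open NE7TopNormalisedSpikeEnergyLetters (energyNormW_le_of_sq_le sq_mul_le_sq_of_one_le)
open NE7TopNormalisedResidualLetters (tangentResidual_letters_of_frameTrivial)
open NE7PureGaugePieceLetters (sum_norm_curl_gaugeDir_le)
open B7Eq92Concrete (dbavgCovIter)
open NE7DbarResidualLetters (tangentResidual_letters_of_dbar)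
open NE7DecompOfTopNormalised (energyNormW_gaugeDir_le_of_masses curlL1_gaugeDir_le_of_mass)
open B7Prop1Explicit B7Prop2Explicit B7Prop3Flat MatrixLog UnitaryModel MatrixNorms
open T4AveragingDeficitWall (Ad IsUnitaryCfg IsSkewDir SmallField vary curl curlSq dirSq dirL1)
open AveragingDeficitMultiLevelPrep (LevelSmall tower TangentIter cavgIter radIter)
open AveragingDeficitTwoLevelPrep (twoLevelSmall)
open AveragingDeficitMultiLevelBridge (cavgIter_eq_avgIter)
open NE3CovariantLineSumsError (Csup Csup_nonneg)
open MinimalActionRate (sfClass)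
open NE3TangentCovariantTower (dirIter QbarIter framePotW)
open BlockAveragePushDirGauge (gaugeDir)
open NE3RightInverseSolveLetters (thetaLoc thetaLoc_nonneg cruxC_le_thetaLoc)
open NE3RightInverseLetters (theta_lt_one_of_loc)
open NE3EnergyShapes (IsUnitarySite IsPeriodicSite)
open NE3ClassRadiusFamily (levelSmall_family_d4_L2 radIter_radSum_le_of_small)
open NE7DecompOfDbar (decomp_of_dbar)
open NE7HdecompOfTopNormalised (pdev_le_of_smallField' ceiling_one ceiling_two ceiling_three ceiling_four radius_identities levelSmall_d4_L2 radSum_d4_L2_le exp_line)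
open NE7HdecompOfDbar (hdecomp_body_of_dbar)

noncomputable section

section General

variable {d : ℕ} {n : Type*} [Fintype n] [DecidableEq n]

/-! ## §1 The curl-ℓ¹ letter of the pure-gauge piece from the quartic ℓ¹ mass -/

/-- **THE CURL-ℓ¹ LETTER OF THE PURE-GAUGE PIECE FROM THE QUARTIC ℓ¹ MASS** (`NE7DecompOfTopNormalised.curlL1_gaugeDir_le_of_mass` WITHOUT the lost factor `M`): from
`Σ_z‖μ z‖ ≤ m₁·M⁴·E²` (exponent FOUR) the same conclusion `x·Σ_p‖curl_W (D_W μ)(p)‖ ≤ 2·#Plane·(M²x)²·m₁·E²`, since `x²·M⁴ = (M²x)²` exactly.  The cubic line of the landed chain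
threw away one power of `M` (`x²M³ ≤ (M²x)²`); with the natural size `Σ‖μ‖ ≍ M⁴‖X‖_w²` of a slice corrector that power is exactly what k-free `m₁` needs (memo ROAD-G98 §3.4). [folklore] -/
theorem curlL1_gaugeDir_le_of_mass_M4 [Nonempty n] {L : ℕ} (hL : 1 ≤ L) (j : ℕ) (Pr : ℕ) {W : Site d → Fin d → (Matrix n n ℂ)ˣ} (hW : IsUnitaryCfg W) {x : ℝ} (hx : 0 ≤ x)
    (hWx : SmallField W x) (μ : Site d → Matrix n n ℂ) {m₁ E : ℝ} (hm₁ : 0 ≤ m₁)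
    (hS : ∑ z ∈ periodBox (d := d) Pr, ‖μ z‖ ≤ m₁ * ((L : ℝ) ^ (j + 1)) ^ 4 * E ^ 2) :
    x * ∑ p ∈ perWin d Pr, ‖curl W (gaugeDir W μ) p‖
      ≤ 2 * (Fintype.card (T4AveragingDeficitWall.Plane d)) * (((L : ℝ) ^ (j + 1)) ^ 2 * x) ^ 2 * m₁ * E ^ 2 := by
  have hL0 : (0 : ℝ) < L := by exact_mod_cast (show 0 < L by omega)
  set M : ℝ := (L : ℝ) ^ (j + 1) with hMdef
  set P : ℝ := (Fintype.card (T4AveragingDeficitWall.Plane d) : ℝ) with hPdef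
  have hP0 : 0 ≤ P := by rw [hPdef]; positivity
  have h := sum_norm_curl_gaugeDir_le Pr hW hWx μ
  have hm0 : 0 ≤ m₁ * M ^ 4 * E ^ 2 := by positivity
  calc x * ∑ p ∈ perWin d Pr, ‖curl W (gaugeDir W μ) p‖
      ≤ x * (2 * x * P * ∑ z ∈ periodBox (d := d) Pr, ‖μ z‖) := mul_le_mul_of_nonneg_left h hx
    _ ≤ x * (2 * x * P * (m₁ * M ^ 4 * E ^ 2)) := by gcongr
    _ = 2 * P * (M ^ 2 * x) ^ 2 * m₁ * E ^ 2 := by ring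

/-! ## §2 S5′ with the quartic mass line -/

/-- **QUARTIC-MASS VERSION (`_M4`) of `NE7DecompOfDbar.decomp_of_dbar`** — identical except the ℓ¹ mass line reads `Σ‖μ‖ ≤ m₁·M⁴·‖X‖_w²` (exponent 4) and the proof uses `curlL1_gaugeDir_le_of_mass_M4`; the conclusion and its constants are unchanged.  ORIGINAL DOCSTRING: **ROAD-Γ′ S5-CONDITIONAL — THE `hdecomp♭` SPLIT AND ITS TWO LETTERS FROM A TOP-NORMALISED REPRESENTATIVE, MODULO THE THREE MASSES OF THE SLICE-CORRECTING GENERATOR.**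
Setting of S4a (`NE7TopNormalisedResidualLetters.tangentResidual_letters_of_frameTrivial`: NE7's pair `U_A^{u} = W·e^{X}` with `u` corner-trivial, common `(j+1)`-fold average, tower class at
`W` of period `N·M`, row NE3's W6 regime, the Prop-4∕(Γ1) regime in `α₀, b`, the ℓ¹ tower line, `44dL·Mb ≤ 1`, TRIVIAL TOP FRAME `v_{j+1} ≡ 1`, ceilings `Γ₁…Γ₄`) plus `2 ≤ L^d` and
the MASS HYPOTHESIS `hμ`: every skew periodic corner-trivial `μ` that puts the tangent residual `X − X_N⁰` into `T_♮(W)` has `dirSq (gaugeDir W μ) ≤ m₂M²‖X‖_w²`, `Σ‖μ‖² ≤ p₂M⁴‖X‖_w²`,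
`Σ‖μ‖ ≤ m₁M³‖X‖_w²` over the period box.  CONCLUSION: `X = X_T + X_N`, `X_T ∈ frameFreeBlockLandauW L N (j+1) W`, `X_N` skew, `‖X_N‖_w ≤ ν‖X‖_w`, `x·Σ_{perWin(N·M)}‖curl_W X_N‖ ≤ κ‖X‖_w²`
with `ν = ν_S + ν_R + √(4(M²x)²·#Plane·p₂ + m₂)` and `κ = κ_S + κ_R + 2·#Plane·(M²x)²·m₁` (`ν_S, ν_R, κ_S, κ_R` of S4a). [folklore] -/
theorem decomp_of_dbar_M4 [Nonempty n] {L N : ℕ} [NeZero N] (hL : 2 ≤ L) (hLd : 2 ≤ L ^ d) (hN : 1 ≤ N) (j : ℕ)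
    {W : Site d → Fin d → (Matrix n n ℂ)ˣ} {x : ℝ} (hWu : IsUnitaryCfg W) (hWP : IsPeriodicCfg W ((N * L ^ (j + 1) : ℕ) : ℤ))
    (hx : 0 ≤ x) (hsm : LevelSmall d L j x) (hWx : SmallField W x)
    (hθ : cruxC d L * (((L : ℝ) ^ (j + 1)) ^ 2 * x) < 1) (hθl : thetaLoc d L * (((L : ℝ) ^ (j + 1)) ^ 2 * x) < 1) (hε : ((L : ℝ) ^ (j + 1)) ^ 2 * x ≤ 1)
    {α₀ b : ℝ} (hα : 0 < α₀) (hα3 : C0 d * (2 * α₀) ≤ 1 / 3) (hα4 : 4 * (2 * α₀) ≤ c2' d L)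
    (h52 : pdev W < α₀ * (((L : ℝ) ^ (j + 1))⁻¹) ^ 2) (hb : 0 ≤ b)
    {X : Site d → Fin d → Matrix n n ℂ} (hX : ∀ (y : Site d) (κ : Fin d), ‖X y κ‖ ≤ b) (hXP : IsPeriodicDir X ((N * L ^ (j + 1) : ℕ) : ℤ)) (hXs : IsSkewDir X)
    (hsmall : Real.exp (4 * (800 * ((d : ℝ) + 1) ^ 2 * ((d : ℝ) + 4)) * α₀)
      * (1 + 8 * (131072 * ((d : ℝ) + 1) ^ 2) * ((L : ℝ) ^ (j + 1) * b)) ≤ 2)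
    (hc₃ : 4 * ((L : ℝ) ^ (j + 1) * b) ≤ c3 d L)
    (hK : 16 * (C1cov d * (L : ℝ) ^ 2 * Real.sqrt (d * (2 * (2 * L) + 1) ^ d)) * (L : ℝ) ^ (j + 1) * b ≤ Real.sqrt ((L : ℝ) ^ 2 / (L : ℝ) ^ d))
    (hS1 : (16 * (d + 1) * (d + 4) * (L : ℝ) ^ 2 * Csup d L * (d * (2 * nbRad d L + 1) ^ d)) * radSum d L j x ≤ ((L : ℝ) / (L : ℝ) ^ d) / 2)
    (h44 : 44 * ((d : ℝ) * L * ((L : ℝ) ^ (j + 1) * b)) ≤ 1)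
    (hdbar : dbavgCovIter L W (relPert W X) (j + 1) = 1)
    {Θ₂ Θ₁ : ℝ} (hΘ₂0 : 0 ≤ Θ₂) (hΘ₂ : ∑ z ∈ periodBox (d := d) N, ‖mlog ((vcov L W (relPert W X) (j + 1) z : (Matrix n n ℂ)ˣ) : Matrix n n ℂ)‖ ^ 2
      ≤ Θ₂ * ((L : ℝ) ^ (j + 1)) ^ 2 * energyNormW L (j + 1) W X (periodBox (d := d) (N * L ^ (j + 1))) ^ 2)
    (hΘ₁0 : 0 ≤ Θ₁) (hΘ₁ : ∑ z ∈ periodBox (d := d) N, ‖mlog ((vcov L W (relPert W X) (j + 1) z : (Matrix n n ℂ)ˣ) : Matrix n n ℂ)‖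
      ≤ Θ₁ * ((L : ℝ) ^ (j + 1)) ^ 2 * energyNormW L (j + 1) W X (periodBox (d := d) (N * L ^ (j + 1))) ^ 2)
    {Γ₁ Γ₂ Γ₃ Γ₄ : ℝ} (hΓ₁ : ∑ m ∈ range (j + 1), (L : ℝ) ^ m * ((L : ℝ) ^ 2 / (L : ℝ) ^ d) ^ m ≤ Γ₁)
    (hΓ₂ : ((j : ℝ) + 1) * ∑ i ∈ range j, ((L : ℝ) ^ 2 * ((L : ℝ) ^ 2 / (L : ℝ) ^ d)) ^ i ≤ Γ₂ * ((L : ℝ) ^ (j + 1)) ^ 2)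
    (hΓ₃ : ∑ i ∈ range j, (((L : ℝ) / (L : ℝ) ^ d) * L) ^ i ≤ Γ₃) (hΓ₄ : ∑ m ∈ range (j + 1), ((L : ℝ) ^ 2 / (L : ℝ) ^ d) ^ m ≤ Γ₄)
    {m₂ p₂ m₁ : ℝ} (hm₂ : 0 ≤ m₂) (hp₂ : 0 ≤ p₂) (hm₁ : 0 ≤ m₁)
    (hμ : ∀ (hYs : IsSkewDir (dirIter L (j + 1) W (fun y ν => X y ν - gaugeDir W (spikeW (L ^ (j + 1)) (framePotW L (j + 1) W X)) y ν)))
        (mu : Site d → Matrix n n ℂ), (∀ y, mu y ∈ skewAdjoint (Matrix n n ℂ)) →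
        (∀ (y : Site d) (i : Fin d), mu (y + ((N * L ^ (j + 1) : ℕ) : ℤ) • e i) = mu y) → (∀ w : Site d, mu (((L : ℤ) ^ (j + 1)) • w) = 0) →
        (fun y ν => (X y ν - (gaugeDir W (spikeW (L ^ (j + 1)) (framePotW L (j + 1) W X)) + rightInvW hL j hWu hx hsm hWx N hθ hYs) y ν) + gaugeDir W mu y ν)
          ∈ frameFreeBlockLandauW (d := d) (n := n) L N (j + 1) W →
        dirSq (gaugeDir W mu) (periodBox (d := d) (N * L ^ (j + 1))) ≤ m₂ * ((L : ℝ) ^ (j + 1)) ^ 2 * energyNormW L (j + 1) W X (periodBox (d := d) (N * L ^ (j + 1))) ^ 2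
        ∧ ∑ z ∈ periodBox (d := d) (N * L ^ (j + 1)), ‖mu z‖ ^ 2 ≤ p₂ * ((L : ℝ) ^ (j + 1)) ^ 4 * energyNormW L (j + 1) W X (periodBox (d := d) (N * L ^ (j + 1))) ^ 2
        ∧ ∑ z ∈ periodBox (d := d) (N * L ^ (j + 1)), ‖mu z‖ ≤ m₁ * ((L : ℝ) ^ (j + 1)) ^ 4 * energyNormW L (j + 1) W X (periodBox (d := d) (N * L ^ (j + 1))) ^ 2) :
    ∃ (XT XN : Site d → Fin d → Matrix n n ℂ) (ν κ : ℝ),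
      X = XT + XN ∧ XT ∈ frameFreeBlockLandauW (d := d) (n := n) L N (j + 1) W ∧ IsSkewDir XN ∧ 0 ≤ ν ∧
      energyNormW L (j + 1) W XN (periodBox (d := d) (N * L ^ (j + 1))) ≤ ν * energyNormW L (j + 1) W X (periodBox (d := d) (N * L ^ (j + 1))) ∧
      x * ∑ p ∈ perWin d (N * L ^ (j + 1)), ‖curl W XN p‖ ≤ κ * energyNormW L (j + 1) W X (periodBox (d := d) (N * L ^ (j + 1))) ^ 2 ∧
      ν = (2 * Real.sqrt (((Fintype.card (T4AveragingDeficitWall.Plane d) : ℝ) + d)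
                * (3 * Θ₂ + (12288 * ((d : ℝ) ^ 3 * (L : ℝ) ^ 5) * Γ₁ + 3072 * ((d : ℝ) * L) * (C1cov d * (L : ℝ) ^ 2 * Real.sqrt (d * (2 * (2 * L) + 1) ^ d)) ^ 2 * Γ₂)
                  * ((L : ℝ) ^ (j + 1) * b) ^ 2))
              + Real.sqrt ((l2C d L / (1 - thetaLoc d L * (((L : ℝ) ^ (j + 1)) ^ 2 * x)) ^ 2 + curl2C d L / (1 - thetaLoc d L * (((L : ℝ) ^ (j + 1)) ^ 2 * x)) ^ 2)
                  * (1024 * (C1cov d * (L : ℝ) ^ 2 * Real.sqrt (d * (2 * (2 * L) + 1) ^ d)) ^ 2 * ((L : ℝ) ^ d / (L : ℝ) ^ 4)))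
                * ((L : ℝ) ^ (j + 1) * b))
            + Real.sqrt (4 * (((L : ℝ) ^ (j + 1)) ^ 2 * x) ^ 2 * (Fintype.card (T4AveragingDeficitWall.Plane d)) * p₂ + m₂) ∧
      κ = (2 * (Fintype.card (T4AveragingDeficitWall.Plane d) : ℝ)
                * (Θ₁ + (16 * ((d : ℝ) * L) * (6 * Γ₁ + 2 * Γ₄) + 64 * (C1cov d * (L : ℝ) ^ 2 * (d * (2 * (2 * (L : ℝ)) + 1) ^ d)) * Γ₃))
                * (((L : ℝ) ^ (j + 1)) ^ 2 * x) ^ 2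
              + (curl1C d L / (1 - thetaLoc d L * (((L : ℝ) ^ (j + 1)) ^ 2 * x))) * (((L : ℝ) ^ (j + 1)) ^ 2 * x)
                * (64 * (C1cov d * (L : ℝ) ^ 2 * (d * (2 * (2 * (L : ℝ)) + 1) ^ d)) * ((L : ℝ) ^ d / (L : ℝ) ^ 2)))
            + 2 * (Fintype.card (T4AveragingDeficitWall.Plane d)) * (((L : ℝ) ^ (j + 1)) ^ 2 * x) ^ 2 * m₁ := by
  have hL1 : 1 ≤ L := by omega
  have hL0 : (0 : ℝ) < L := by exact_mod_cast (show 0 < L by omega)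
  have hT : ((tower L N (j + 1) : ℕ) : ℤ) = ((N * L ^ (j + 1) : ℕ) : ℤ) := by rw [tower_eq_pow_mul, Nat.mul_comm]
  have hWPt : IsPeriodicCfg W ((tower L N (j + 1) : ℕ) : ℤ) := by rw [hT]; exact hWP
  set F := periodBox (d := d) (N * L ^ (j + 1)) with hF
  set E : ℝ := energyNormW L (j + 1) W X F with hE
  have hE0 : 0 ≤ E := energyNormW_nonneg _ _ _ _ _
  -- S4a: the tangent residual and the letters of `X_N⁰`
  obtain ⟨hYs, XN0, hXN0, htan, hN0s, hN0P, hν0, hκ0⟩ :=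
    tangentResidual_letters_of_dbar hL hN j hWu hWP hx hsm hWx hθ hθl hε hα hα3 hα4 h52 hb hX hXP hXs hsmall hc₃ hK hS1 h44
      hdbar hΘ₂0 hΘ₂ hΘ₁0 hΘ₁ hΓ₁ hΓ₂ hΓ₃ hΓ₄
  -- the tangent residual `Y' := X − X_N⁰`
  set Y' : Site d → Fin d → Matrix n n ℂ := fun y ν => X y ν - XN0 y ν with hY'
  have hY's : IsSkewDir Y' := fun y ν => (skewAdjoint (Matrix n n ℂ)).sub_mem (hXs y ν) (hN0s y ν)
  have hY'P : IsPeriodicDir Y' ((tower L N (j + 1) : ℕ) : ℤ) := by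
    rw [hT]; intro y i ν; simp only [hY']; rw [hXP y i ν, hN0P y i ν]
  have hY'T : TangentIter L j W Y' := (tangentIter_iff_dirIter_eq_zero L j W Y').mpr htan
  -- leaf-02: the corner-trivial slice-correcting generator
  obtain ⟨mu, hmus, hmuP, hmu0, hmem⟩ := exists_cornerGauge_mem_frameFreeBlockLandauW (M := N) hL1 hLd j hWu hWPt hx hsm hWx hY's hY'P hY'T
  have hmuP' : ∀ (y : Site d) (i : Fin d), mu (y + ((N * L ^ (j + 1) : ℕ) : ℤ) • e i) = mu y := by rw [← hT]; exact hmuP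
  -- the three masses
  have hmem' : (fun y ν => (X y ν - (gaugeDir W (spikeW (L ^ (j + 1)) (framePotW L (j + 1) W X)) + rightInvW hL j hWu hx hsm hWx N hθ hYs) y ν)
      + gaugeDir W mu y ν) ∈ frameFreeBlockLandauW (d := d) (n := n) L N (j + 1) W := by
    rw [← hXN0]; exact hmem
  obtain ⟨hD, hS2, hS1'⟩ := hμ hYs mu hmus hmuP' hmu0 hmem'
  -- the pieces
  set G : Site d → Fin d → Matrix n n ℂ := gaugeDir W mu with hG
  have hGs : IsSkewDir G := gaugeDir_skew hWu hmus
  set P : ℝ := (Fintype.card (T4AveragingDeficitWall.Plane d) : ℝ) with hPdef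
  set M : ℝ := (L : ℝ) ^ (j + 1) with hMdef
  -- the letters of the pure gauge piece
  have hνμ : energyNormW L (j + 1) W G F ≤ Real.sqrt (4 * (M ^ 2 * x) ^ 2 * P * p₂ + m₂) * E :=
    energyNormW_gaugeDir_le_of_masses hL1 j hWu hWx mu F hm₂ hp₂ hE0 hD hS2
  have hκμ : x * ∑ p ∈ perWin d (N * L ^ (j + 1)), ‖curl W G p‖ ≤ 2 * P * (M ^ 2 * x) ^ 2 * m₁ * E ^ 2 :=
    curlL1_gaugeDir_le_of_mass_M4 hL1 j (N * L ^ (j + 1)) hWu hx hWx mu hm₁ hS1'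
  -- positivity of the S4a constants
  set νS : ℝ := 2 * Real.sqrt ((P + d) * (3 * Θ₂ + (12288 * ((d : ℝ) ^ 3 * (L : ℝ) ^ 5) * Γ₁ + 3072 * ((d : ℝ) * L) * (C1cov d * (L : ℝ) ^ 2 * Real.sqrt (d * (2 * (2 * L) + 1) ^ d)) ^ 2 * Γ₂)
      * (M * b) ^ 2)) with hνS
  set νR : ℝ := Real.sqrt ((l2C d L / (1 - thetaLoc d L * (M ^ 2 * x)) ^ 2 + curl2C d L / (1 - thetaLoc d L * (M ^ 2 * x)) ^ 2)
      * (1024 * (C1cov d * (L : ℝ) ^ 2 * Real.sqrt (d * (2 * (2 * L) + 1) ^ d)) ^ 2 * ((L : ℝ) ^ d / (L : ℝ) ^ 4))) * (M * b) with hνR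
  set νμ : ℝ := Real.sqrt (4 * (M ^ 2 * x) ^ 2 * P * p₂ + m₂) with hνμdef
  have hνS0 : 0 ≤ νS := by rw [hνS]; positivity
  have hνR0 : 0 ≤ νR := by rw [hνR]; positivity
  have hνμ0 : 0 ≤ νμ := Real.sqrt_nonneg _
  set κS : ℝ := 2 * P * (Θ₁ + (16 * ((d : ℝ) * L) * (6 * Γ₁ + 2 * Γ₄) + 64 * (C1cov d * (L : ℝ) ^ 2 * (d * (2 * (2 * (L : ℝ)) + 1) ^ d)) * Γ₃)) * (M ^ 2 * x) ^ 2 with hκS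
  set κR : ℝ := (curl1C d L / (1 - thetaLoc d L * (M ^ 2 * x))) * (M ^ 2 * x) * (64 * (C1cov d * (L : ℝ) ^ 2 * (d * (2 * (2 * (L : ℝ)) + 1) ^ d)) * ((L : ℝ) ^ d / (L : ℝ) ^ 2))
    with hκR
  set κμ : ℝ := 2 * P * (M ^ 2 * x) ^ 2 * m₁ with hκμdef
  refine ⟨fun y ν => Y' y ν + G y ν, XN0 - G, νS + νR + νμ, κS + κR + κμ, ?_, hmem, ?_, by positivity, ?_, ?_, rfl, rfl⟩
  · -- `X = X_T + X_N`
    funext y ν; simp only [hY', Pi.add_apply, Pi.sub_apply]; abel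
  · -- skewness of `X_N`
    intro y ν; simpa only [Pi.sub_apply] using (skewAdjoint (Matrix n n ℂ)).sub_mem (hN0s y ν) (hGs y ν)
  · -- the ν-letter
    have hsub := energyNormW_sub_le L (j + 1) W XN0 G F
    calc energyNormW L (j + 1) W (XN0 - G) F ≤ energyNormW L (j + 1) W XN0 F + energyNormW L (j + 1) W G F := hsub
      _ ≤ (νS + νR) * E + νμ * E := add_le_add hν0 hνμ
      _ = (νS + νR + νμ) * E := by ring
  · -- the κ-letter
    have hsum : ∑ p ∈ perWin d (N * L ^ (j + 1)), ‖curl W (XN0 - G) p‖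
        ≤ ∑ p ∈ perWin d (N * L ^ (j + 1)), ‖curl W XN0 p‖ + ∑ p ∈ perWin d (N * L ^ (j + 1)), ‖curl W G p‖ := by
      rw [← Finset.sum_add_distrib]
      refine Finset.sum_le_sum fun p _ => ?_
      rw [curl_sub_dir]; exact norm_sub_le _ _
    calc x * ∑ p ∈ perWin d (N * L ^ (j + 1)), ‖curl W (XN0 - G) p‖
        ≤ x * (∑ p ∈ perWin d (N * L ^ (j + 1)), ‖curl W XN0 p‖ + ∑ p ∈ perWin d (N * L ^ (j + 1)), ‖curl W G p‖) :=
          mul_le_mul_of_nonneg_left hsum hx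
      _ = x * ∑ p ∈ perWin d (N * L ^ (j + 1)), ‖curl W XN0 p‖ + x * ∑ p ∈ perWin d (N * L ^ (j + 1)), ‖curl W G p‖ := mul_add _ _ _
      _ ≤ (κS + κR) * E ^ 2 + κμ * E ^ 2 := add_le_add hκ0 hκμ
      _ = (κS + κR + κμ) * E ^ 2 := by ring

end General

section D4

variable {n : Type} [Fintype n] [DecidableEq n]

/-! ## §3 Binder′ with the quartic mass line (`d = 4`, `L = 2`) -/

/-- **QUARTIC-MASS VERSION (`_M4`) of `NE7HdecompOfDbar.hdecomp_body_of_dbar`** — identical except the ℓ¹ mass line has exponent 4 (`m₁·M⁴·‖X‖_w²`); proof over `decomp_of_dbar_M4`.  ORIGINAL DOCSTRING: **THE PER-PAIR BINDER `hdecomp♭` FROM (A) A TOP-NORMALISED REPRESENTATIVE AND (B) THE THREE MASSES** (`d = 4`, `L = 2`, level `k+1`, `M = 2^{k+1}`, `x = ε∕M²`).  ε-LINES: `ε ≤ 10⁻¹¹`,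
`thetaLoc·ε < 1`, `C0·4ε ≤ 1∕3`, `16ε ≤ c2'`, the ℓ¹ tower line at radius `(8∕3)(ε∕4)`; α̂-LINES: `8·131072·25·α̂ ≤ 1∕10`, `4α̂ ≤ c3`, the `hK` line, `352α̂ ≤ 1`.  CLASS DATA: `U_s` unitary
`(N·M)`-periodic with `SmallField U_s x`, common `(k+1)`-fold average `D` of `U_s` and `U′`.  (A): a unitary CORNER-TRIVIAL gauge `u`, a skew `(N·M)`-periodic `X` with `sup‖X‖ ≤ b`, `M·b ≤ α̂`,
`U′^{u} = U_s·e^{X}` and TRIVIAL ACCUMULATED TOP FRAME `v_{k+1} ≡ 1`.  (B): the three masses `(m₂, p₂, m₁)` of every corner-trivial slice-correcting generator of the tangent residual (the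
hypothesis `hμ` of `NE7DecompOfTopNormalised.decomp_of_topNormalised`, its proof arguments universally bound).  LINES ON THE CEILINGS: `ν(α̂, ε, m₂, p₂) ≤ ν̂`, `κ(ε, m₁) ≤ κ̂` (displayed).
CONCLUSION: the body of `hdecomp♭` of `NE7HintOfSliceNormalisationSU2Dec.hint_SU2_of_decomposition` for this pair, with `α = b`. [folklore] -/
theorem hdecomp_body_of_dbar_M4 [Nonempty n] {N : ℕ} [NeZero N] (hN : 1 ≤ N) (k : ℕ) {ε : ℝ} (hε : 0 < ε)
    (hε11 : ε ≤ 1 / 10 ^ 11) (hεθ : thetaLoc 4 2 * ε < 1) (hεC0 : C0 4 * (2 * (2 * ε)) ≤ 1 / 3) (hεc2 : 4 * (2 * (2 * ε)) ≤ c2' 4 2)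
    (hεS1 : 16 * (((4 : ℕ) : ℝ) + 1) * (((4 : ℕ) : ℝ) + 4) * ((2 : ℕ) : ℝ) ^ 2 * Csup 4 2 * (((4 : ℕ) : ℝ) * (2 * ((nbRad 4 2 : ℕ) : ℝ) + 1) ^ 4) * (8 / 3 * (ε / 4))
      ≤ ((2 : ℕ) : ℝ) / ((2 : ℕ) : ℝ) ^ 4 / 2)
    {Us U' : Site 4 → Fin 4 → (Matrix n n ℂ)ˣ} (hWu : IsUnitaryCfg Us) (hWP : IsPeriodicCfg Us ((N * 2 ^ (k + 1) : ℕ) : ℤ))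
    (hWx : SmallField Us (ε / (((2 : ℕ) : ℝ) ^ (k + 1)) ^ 2))
    {αh : ℝ} (hαh1 : 8 * (131072 * (((4 : ℕ) : ℝ) + 1) ^ 2) * αh ≤ 1 / 10) (hαh2 : 4 * αh ≤ c3 4 2)
    (hαh3 : 16 * (C1cov 4 * ((2 : ℕ) : ℝ) ^ 2 * Real.sqrt (((4 : ℕ) : ℝ) * (2 * (2 * ((2 : ℕ) : ℝ)) + 1) ^ 4)) * αh ≤ Real.sqrt (((2 : ℕ) : ℝ) ^ 2 / ((2 : ℕ) : ℝ) ^ 4))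
    (hαh4 : 44 * (((4 : ℕ) : ℝ) * ((2 : ℕ) : ℝ) * αh) ≤ 1)
    {u : Site 4 → (Matrix n n ℂ)ˣ} {X : Site 4 → Fin 4 → Matrix n n ℂ} {b : ℝ}
    (hu : IsUnitarySite u) (hXs : IsSkewDir X) (hXP : IsPeriodicDir X ((N * 2 ^ (k + 1) : ℕ) : ℤ))
    (hb : 0 ≤ b) (hX : ∀ (y : Site 4) (κ : Fin 4), ‖X y κ‖ ≤ b) (hrep : gaugeAct u U' = vary Us X 1)
    (hdbar : dbavgCovIter 2 Us (relPert Us X) (k + 1) = 1) (hbα : ((2 : ℕ) : ℝ) ^ (k + 1) * b ≤ αh)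
    {Θ₂ Θ₁ : ℝ} (hΘ₂0 : 0 ≤ Θ₂) (hΘ₂ : ∑ z ∈ periodBox (d := 4) N, ‖mlog ((vcov 2 Us (relPert Us X) (k + 1) z : (Matrix n n ℂ)ˣ) : Matrix n n ℂ)‖ ^ 2
      ≤ Θ₂ * (((2 : ℕ) : ℝ) ^ (k + 1)) ^ 2 * energyNormW 2 (k + 1) Us X (periodBox (d := 4) (N * 2 ^ (k + 1))) ^ 2)
    (hΘ₁0 : 0 ≤ Θ₁) (hΘ₁ : ∑ z ∈ periodBox (d := 4) N, ‖mlog ((vcov 2 Us (relPert Us X) (k + 1) z : (Matrix n n ℂ)ˣ) : Matrix n n ℂ)‖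
      ≤ Θ₁ * (((2 : ℕ) : ℝ) ^ (k + 1)) ^ 2 * energyNormW 2 (k + 1) Us X (periodBox (d := 4) (N * 2 ^ (k + 1))) ^ 2)
    {m₂ p₂ m₁ : ℝ} (hm₂ : 0 ≤ m₂) (hp₂ : 0 ≤ p₂) (hm₁ : 0 ≤ m₁)
    (hμ : ∀ (hx0 : 0 ≤ ε / (((2 : ℕ) : ℝ) ^ (k + 1)) ^ 2) (hsm0 : LevelSmall 4 2 k (ε / (((2 : ℕ) : ℝ) ^ (k + 1)) ^ 2))
        (hθ0 : cruxC 4 2 * ((((2 : ℕ) : ℝ) ^ (k + 1)) ^ 2 * (ε / (((2 : ℕ) : ℝ) ^ (k + 1)) ^ 2)) < 1)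
        (hYs : IsSkewDir (dirIter 2 (k + 1) Us (fun y ν => X y ν - gaugeDir Us (spikeW (2 ^ (k + 1)) (framePotW 2 (k + 1) Us X)) y ν)))
        (mu : Site 4 → Matrix n n ℂ), (∀ y, mu y ∈ skewAdjoint (Matrix n n ℂ)) →
        (∀ (y : Site 4) (i : Fin 4), mu (y + ((N * 2 ^ (k + 1) : ℕ) : ℤ) • e i) = mu y) → (∀ w : Site 4, mu ((((2 : ℕ) : ℤ) ^ (k + 1)) • w) = 0) →
        (fun y ν => (X y ν - (gaugeDir Us (spikeW (2 ^ (k + 1)) (framePotW 2 (k + 1) Us X)) + rightInvW (le_refl 2) k hWu hx0 hsm0 hWx N hθ0 hYs) y ν) + gaugeDir Us mu y ν)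
          ∈ frameFreeBlockLandauW (d := 4) (n := n) 2 N (k + 1) Us →
        dirSq (gaugeDir Us mu) (periodBox (d := 4) (N * 2 ^ (k + 1))) ≤ m₂ * (((2 : ℕ) : ℝ) ^ (k + 1)) ^ 2 * energyNormW 2 (k + 1) Us X (periodBox (d := 4) (N * 2 ^ (k + 1))) ^ 2
        ∧ ∑ z ∈ periodBox (d := 4) (N * 2 ^ (k + 1)), ‖mu z‖ ^ 2 ≤ p₂ * (((2 : ℕ) : ℝ) ^ (k + 1)) ^ 4 * energyNormW 2 (k + 1) Us X (periodBox (d := 4) (N * 2 ^ (k + 1))) ^ 2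
        ∧ ∑ z ∈ periodBox (d := 4) (N * 2 ^ (k + 1)), ‖mu z‖ ≤ m₁ * (((2 : ℕ) : ℝ) ^ (k + 1)) ^ 4 * energyNormW 2 (k + 1) Us X (periodBox (d := 4) (N * 2 ^ (k + 1))) ^ 2)
    {νh κh : ℝ}
    (hνh : 2 * Real.sqrt (((Fintype.card (T4AveragingDeficitWall.Plane 4) : ℝ) + ((4 : ℕ) : ℝ))
            * (3 * Θ₂ + (12288 * ((((4 : ℕ) : ℝ)) ^ 3 * ((2 : ℕ) : ℝ) ^ 5) * 2 + 3072 * ((((4 : ℕ) : ℝ)) * ((2 : ℕ) : ℝ)) * (C1cov 4 * ((2 : ℕ) : ℝ) ^ 2 * Real.sqrt (((4 : ℕ) : ℝ) * (2 * (2 * ((2 : ℕ) : ℝ)) + 1) ^ 4)) ^ 2 * 1)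
              * αh ^ 2))
          + Real.sqrt ((l2C 4 2 / (1 - thetaLoc 4 2 * ε) ^ 2 + curl2C 4 2 / (1 - thetaLoc 4 2 * ε) ^ 2)
              * (1024 * (C1cov 4 * ((2 : ℕ) : ℝ) ^ 2 * Real.sqrt (((4 : ℕ) : ℝ) * (2 * (2 * ((2 : ℕ) : ℝ)) + 1) ^ 4)) ^ 2 * (((2 : ℕ) : ℝ) ^ 4 / ((2 : ℕ) : ℝ) ^ 4))) * αh
          + Real.sqrt (4 * ε ^ 2 * (Fintype.card (T4AveragingDeficitWall.Plane 4)) * p₂ + m₂) ≤ νh)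
    (hκh : 2 * (Fintype.card (T4AveragingDeficitWall.Plane 4) : ℝ)
            * (Θ₁ + (16 * ((((4 : ℕ) : ℝ)) * ((2 : ℕ) : ℝ)) * (6 * 2 + 2 * (4 / 3)) + 64 * (C1cov 4 * ((2 : ℕ) : ℝ) ^ 2 * (((4 : ℕ) : ℝ) * (2 * (2 * ((2 : ℕ) : ℝ)) + 1) ^ 4)) * (4 / 3))) * ε ^ 2
          + (curl1C 4 2 / (1 - thetaLoc 4 2 * ε)) * ε * (64 * (C1cov 4 * ((2 : ℕ) : ℝ) ^ 2 * (((4 : ℕ) : ℝ) * (2 * (2 * ((2 : ℕ) : ℝ)) + 1) ^ 4)) * (((2 : ℕ) : ℝ) ^ 4 / ((2 : ℕ) : ℝ) ^ 2))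
          + 2 * (Fintype.card (T4AveragingDeficitWall.Plane 4)) * ε ^ 2 * m₁ ≤ κh) :
    ∃ (u : Site 4 → (Matrix n n ℂ)ˣ) (X XT XN : Site 4 → Fin 4 → Matrix n n ℂ) (α ν κ : ℝ),
      IsUnitarySite u ∧ IsSkewDir X ∧ IsPeriodicDir X ((N * 2 ^ (k + 1) : ℕ) : ℤ) ∧ 0 ≤ α ∧ (∀ x μ, ‖X x μ‖ ≤ α) ∧
      gaugeAct u U' = vary Us X 1 ∧
      X = XT + XN ∧ XT ∈ frameFreeBlockLandauW (d := 4) (n := n) 2 N (k + 1) Us ∧ IsSkewDir XN ∧ 0 ≤ ν ∧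
      energyNormW 2 (k + 1) Us XN (periodBox (d := 4) (N * 2 ^ (k + 1)))
        ≤ ν * energyNormW 2 (k + 1) Us X (periodBox (d := 4) (N * 2 ^ (k + 1))) ∧
      ε / (((2 : ℕ) : ℝ) ^ (k + 1)) ^ 2 * (∑ p ∈ perWin 4 (N * 2 ^ (k + 1)), ‖curl Us XN p‖)
        ≤ κ * energyNormW 2 (k + 1) Us X (periodBox (d := 4) (N * 2 ^ (k + 1))) ^ 2 ∧
      α * ((2 : ℕ) : ℝ) ^ (k + 1) ≤ αh ∧ ν ≤ νh ∧ κ ≤ κh := by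
  -- the radius identities (no `set`: the binder types of `hμ` depend on these terms)
  have hid := radius_identities k ε
  have hM0 : (0 : ℝ) < ((2 : ℕ) : ℝ) ^ (k + 1) := by positivity
  have hx0 : 0 ≤ ε / (((2 : ℕ) : ℝ) ^ (k + 1)) ^ 2 := by positivity
  have hsm0 : LevelSmall 4 2 k (ε / (((2 : ℕ) : ℝ) ^ (k + 1)) ^ 2) := levelSmall_d4_L2 hε.le hε11 k
  have hθl0 : thetaLoc 4 2 * ((((2 : ℕ) : ℝ) ^ (k + 1)) ^ 2 * (ε / (((2 : ℕ) : ℝ) ^ (k + 1)) ^ 2)) < 1 := by rw [hid.2]; exact hεθ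
  have hθ0 : cruxC 4 2 * ((((2 : ℕ) : ℝ) ^ (k + 1)) ^ 2 * (ε / (((2 : ℕ) : ℝ) ^ (k + 1)) ^ 2)) < 1 := theta_lt_one_of_loc (d := 4) k hx0 hθl0
  have hε1 : (((2 : ℕ) : ℝ) ^ (k + 1)) ^ 2 * (ε / (((2 : ℕ) : ℝ) ^ (k + 1)) ^ 2) ≤ 1 := by
    rw [hid.2]; norm_num at hε11; linarith
  have hMb : 0 ≤ ((2 : ℕ) : ℝ) ^ (k + 1) * b := by positivity
  have hαh0 : 0 ≤ αh := hMb.trans hbα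
  -- the decomposition with all regime binders discharged
  obtain ⟨XT, XN, ν, κ, hXeq, hTmem, hNs, hν0, hN1, hN2, hνeq, hκeq⟩ :=
    decomp_of_dbar_M4 (d := 4) (L := 2) (N := N) (le_refl 2) (by norm_num) hN k (W := Us)
      (x := ε / (((2 : ℕ) : ℝ) ^ (k + 1)) ^ 2)
      hWu hWP hx0 hsm0 hWx hθ0 hθl0 hε1 (α₀ := 2 * ε) (b := b) (by positivity) hεC0 hεc2
      (by
        have h1 := pdev_le_of_smallField' hx0 hWx
        have h2 : ε / (((2 : ℕ) : ℝ) ^ (k + 1)) ^ 2 < 2 * ε * ((((2 : ℕ) : ℝ) ^ (k + 1))⁻¹) ^ 2 := by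
          rw [inv_pow, ← div_eq_mul_inv]
          exact div_lt_div_of_pos_right (by linarith) (by positivity)
        exact lt_of_le_of_lt h1 h2)
      hb hX hXP hXs
      (by
        refine exp_line (by positivity) ?_ (by positivity) ?_
        · norm_num at hε11 ⊢; nlinarith
        · have h : 8 * (131072 * (((4 : ℕ) : ℝ) + 1) ^ 2) * (((2 : ℕ) : ℝ) ^ (k + 1) * b) ≤ 8 * (131072 * (((4 : ℕ) : ℝ) + 1) ^ 2) * αh :=
            mul_le_mul_of_nonneg_left hbα (by positivity)
          exact h.trans hαh1)
      (by linarith [hbα, hαh2])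
      (by
        have hK0 : 0 ≤ 16 * (C1cov 4 * ((2 : ℕ) : ℝ) ^ 2 * Real.sqrt (((4 : ℕ) : ℝ) * (2 * (2 * ((2 : ℕ) : ℝ)) + 1) ^ 4)) := by
          have := C1cov_pos 4; positivity
        have h : 16 * (C1cov 4 * ((2 : ℕ) : ℝ) ^ 2 * Real.sqrt (((4 : ℕ) : ℝ) * (2 * (2 * ((2 : ℕ) : ℝ)) + 1) ^ 4)) * ((2 : ℕ) : ℝ) ^ (k + 1) * b
            = 16 * (C1cov 4 * ((2 : ℕ) : ℝ) ^ 2 * Real.sqrt (((4 : ℕ) : ℝ) * (2 * (2 * ((2 : ℕ) : ℝ)) + 1) ^ 4)) * (((2 : ℕ) : ℝ) ^ (k + 1) * b) := by ring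
        rw [h]
        exact (mul_le_mul_of_nonneg_left hbα hK0).trans hαh3)
      (by
        have hr := radSum_d4_L2_le hε.le hε11 k
        have hC : 0 ≤ 16 * (((4 : ℕ) : ℝ) + 1) * (((4 : ℕ) : ℝ) + 4) * ((2 : ℕ) : ℝ) ^ 2 * Csup 4 2 * (((4 : ℕ) : ℝ) * (2 * ((nbRad 4 2 : ℕ) : ℝ) + 1) ^ 4) := by
          have := Csup_nonneg 4 2; positivity
        exact (mul_le_mul_of_nonneg_left hr hC).trans hεS1)
      (by
        calc 44 * ((((4 : ℕ) : ℝ)) * ((2 : ℕ) : ℝ) * (((2 : ℕ) : ℝ) ^ (k + 1) * b))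
            = 44 * (((4 : ℕ) : ℝ) * ((2 : ℕ) : ℝ)) * (((2 : ℕ) : ℝ) ^ (k + 1) * b) := by ring
          _ ≤ 44 * (((4 : ℕ) : ℝ) * ((2 : ℕ) : ℝ)) * αh := mul_le_mul_of_nonneg_left hbα (by positivity)
          _ = 44 * (((4 : ℕ) : ℝ) * ((2 : ℕ) : ℝ) * αh) := by ring
          _ ≤ 1 := hαh4)
      hdbar hΘ₂0 hΘ₂ hΘ₁0 hΘ₁
      (Γ₁ := 2) (Γ₂ := 1) (Γ₃ := 4 / 3) (Γ₄ := 4 / 3) (ceiling_one k) (ceiling_two k) (ceiling_three k) (ceiling_four k)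
      hm₂ hp₂ hm₁ (fun hYs mu h1 h2 h3 h4 => hμ hx0 hsm0 hθ0 hYs mu h1 h2 h3 h4)
  -- the currencies
  rw [hid.2] at hνeq hκeq
  have hsq : (((2 : ℕ) : ℝ) ^ (k + 1) * b) ^ 2 ≤ αh ^ 2 := pow_le_pow_left₀ hMb hbα 2
  have key : ∀ {P' T A' B C : ℝ}, 0 ≤ P' → 0 ≤ A' → 0 ≤ B →
      2 * Real.sqrt (P' * (T + A' * αh ^ 2)) + B * αh + C ≤ νh →
      2 * Real.sqrt (P' * (T + A' * (((2 : ℕ) : ℝ) ^ (k + 1) * b) ^ 2)) + B * (((2 : ℕ) : ℝ) ^ (k + 1) * b) + C ≤ νh := by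
    intro P' T A' B C hP' hA' hB h
    have h0 : A' * (((2 : ℕ) : ℝ) ^ (k + 1) * b) ^ 2 ≤ A' * αh ^ 2 := mul_le_mul_of_nonneg_left hsq hA'
    have h1 : P' * (T + A' * (((2 : ℕ) : ℝ) ^ (k + 1) * b) ^ 2) ≤ P' * (T + A' * αh ^ 2) :=
      mul_le_mul_of_nonneg_left (by linarith) hP'
    have h2 := Real.sqrt_le_sqrt h1
    have h3 := mul_le_mul_of_nonneg_left hbα hB
    linarith
  refine ⟨u, X, XT, XN, b, ν, κ, hu, hXs, hXP, hb, hX, hrep, hXeq, hTmem, hNs, hν0, hN1, hN2, ?_, ?_, ?_⟩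
  · rw [mul_comm]; exact hbα
  · rw [hνeq]
    exact key (by positivity) (by have := C1cov_pos 4; positivity) (by positivity) hνh
  · rw [hκeq]; exact hκh

end D4

end

end Summit.QuantumFields.BalabanUV.T4Continuum.NE7DbarChainM4
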